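import Summits.Ventures.GridStability.Bench.WSCC9Deg4ASosgramDinstData1
import Summits.Ventures.GridStability.Bench.WSCC9Deg4ASosgramDinstRoaData1
import Summits.Ventures.GridStability.Bench.WSCC9Deg4ASosgramDinstRoaData2
import Literature.Computation.Certificates.LieDerivative
import Mathlib.Tactic.IntervalCases
import HarnessLib

/-!
# G1.WSCC9+ deg-4 (D-INSTANCE)-roa — the CHUNKED Lie-derivative link `V̇ = Σ_k f_k·∂_kV` (kernel, one `decide` per field component)

Venture GRIDFUSION; seat gridfusion-sos-3 (g3). Kernel part of the «…Roa» companion of `Bench/WSCC9Deg4ASosgramDinst`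
(certnum-sdp-3 A′ certificate 9d83c75afa575de8 of sos-3's claim 741461ba): the chain rule along solutions needs
`V̇_poly = lieDeriv f V_poly`; for this 253-monomial `V` (7 field components, `V̇` 663 monomials) the one-`decide`
link of lyap-1's gen6 template does NOT reduce (measured 2026-08-27, ≈ 130 s «did not reduce»), so the identity is
checked per FIELD COMPONENT against literal partial sums `…lieP_k` (`…RoaData1/2.lean`, generator
cert/sos-3/tools/mk_liechunks.py, exact rationals): `P_{k+1} − P_k = norm (f_k · ∂_k V)` for `k = 0..6` and
`V̇ = P_7` — each a separate `decide +kernel` (measured 5–30 s). `Lyapunov/PolyRecastLieChunks.lean` (p503611) turns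
the links into `eval V̇ = eval (lieDeriv f V)` and the curve-form chain rule. THREE COLUMNS: pure kernel bookkeeping
about the certificate's polynomials (MODEL M′ = WSCC9-postB-SPdamp-h12); nothing VALIDATED; no sentence about a grid.
-/

namespace Summit.Ventures.GridStability.Bench.WSCC9

open Literature.Computation.Certificates Literature.Computation.Certificates.SOS

/-- `numVars V_poly = 7` (every variable occurs; one `decide`). [folklore] -/
theorem deg4_A_sosgram_Dinst_V_numVars : Poly.numVars deg4_A_sosgram_Dinst_V_poly = 7 := by
  decide +kernel

set_option maxRecDepth 100000 in
/-- Lie-derivative LINK for field component 0 (`f_sigma_2`): `P_1 − P_0 = f_0·∂_0V` as polynomials (one kernel `decide`;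
partial sums `…lieP_k` = `Bench/WSCC9Deg4ASosgramDinstRoaData1/2`). [folklore] -/
theorem deg4_A_sosgram_Dinst_lieLink_0 : Poly.isZero (Poly.add (Poly.add deg4_A_sosgram_Dinst_lieP_1 (Poly.neg ([] : Poly)))
    (Poly.neg (Poly.norm (Poly.mul deg4_A_sosgram_Dinst_f_sigma_2_poly (Poly.pderiv 0 deg4_A_sosgram_Dinst_V_poly))))) = true := by
  decide +kernel

set_option maxRecDepth 100000 in
/-- Lie-derivative LINK for field component 1 (`f_kappa_2`): `P_2 − P_1 = f_1·∂_1V` as polynomials (one kernel `decide`;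
partial sums `…lieP_k` = `Bench/WSCC9Deg4ASosgramDinstRoaData1/2`). [folklore] -/
theorem deg4_A_sosgram_Dinst_lieLink_1 : Poly.isZero (Poly.add (Poly.add deg4_A_sosgram_Dinst_lieP_2 (Poly.neg deg4_A_sosgram_Dinst_lieP_1))
    (Poly.neg (Poly.norm (Poly.mul deg4_A_sosgram_Dinst_f_kappa_2_poly (Poly.pderiv 1 deg4_A_sosgram_Dinst_V_poly))))) = true := by
  decide +kernel

set_option maxRecDepth 100000 in
/-- Lie-derivative LINK for field component 2 (`f_sigma_3`): `P_3 − P_2 = f_2·∂_2V` as polynomials (one kernel `decide`;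
partial sums `…lieP_k` = `Bench/WSCC9Deg4ASosgramDinstRoaData1/2`). [folklore] -/
theorem deg4_A_sosgram_Dinst_lieLink_2 : Poly.isZero (Poly.add (Poly.add deg4_A_sosgram_Dinst_lieP_3 (Poly.neg deg4_A_sosgram_Dinst_lieP_2))
    (Poly.neg (Poly.norm (Poly.mul deg4_A_sosgram_Dinst_f_sigma_3_poly (Poly.pderiv 2 deg4_A_sosgram_Dinst_V_poly))))) = true := by
  decide +kernel

set_option maxRecDepth 100000 in
/-- Lie-derivative LINK for field component 3 (`f_kappa_3`): `P_4 − P_3 = f_3·∂_3V` as polynomials (one kernel `decide`;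
partial sums `…lieP_k` = `Bench/WSCC9Deg4ASosgramDinstRoaData1/2`). [folklore] -/
theorem deg4_A_sosgram_Dinst_lieLink_3 : Poly.isZero (Poly.add (Poly.add deg4_A_sosgram_Dinst_lieP_4 (Poly.neg deg4_A_sosgram_Dinst_lieP_3))
    (Poly.neg (Poly.norm (Poly.mul deg4_A_sosgram_Dinst_f_kappa_3_poly (Poly.pderiv 3 deg4_A_sosgram_Dinst_V_poly))))) = true := by
  decide +kernel

set_option maxRecDepth 100000 in
/-- Lie-derivative LINK for field component 4 (`f_omega_1`): `P_5 − P_4 = f_4·∂_4V` as polynomials (one kernel `decide`;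
partial sums `…lieP_k` = `Bench/WSCC9Deg4ASosgramDinstRoaData1/2`). [folklore] -/
theorem deg4_A_sosgram_Dinst_lieLink_4 : Poly.isZero (Poly.add (Poly.add deg4_A_sosgram_Dinst_lieP_5 (Poly.neg deg4_A_sosgram_Dinst_lieP_4))
    (Poly.neg (Poly.norm (Poly.mul deg4_A_sosgram_Dinst_f_omega_1_poly (Poly.pderiv 4 deg4_A_sosgram_Dinst_V_poly))))) = true := by
  decide +kernel

set_option maxRecDepth 100000 in
/-- Lie-derivative LINK for field component 5 (`f_omega_2`): `P_6 − P_5 = f_5·∂_5V` as polynomials (one kernel `decide`;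
partial sums `…lieP_k` = `Bench/WSCC9Deg4ASosgramDinstRoaData1/2`). [folklore] -/
theorem deg4_A_sosgram_Dinst_lieLink_5 : Poly.isZero (Poly.add (Poly.add deg4_A_sosgram_Dinst_lieP_6 (Poly.neg deg4_A_sosgram_Dinst_lieP_5))
    (Poly.neg (Poly.norm (Poly.mul deg4_A_sosgram_Dinst_f_omega_2_poly (Poly.pderiv 5 deg4_A_sosgram_Dinst_V_poly))))) = true := by
  decide +kernel

set_option maxRecDepth 100000 in
/-- Lie-derivative LINK for field component 6 (`f_omega_3`): `P_7 − P_6 = f_6·∂_6V` as polynomials (one kernel `decide`;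
partial sums `…lieP_k` = `Bench/WSCC9Deg4ASosgramDinstRoaData1/2`). [folklore] -/
theorem deg4_A_sosgram_Dinst_lieLink_6 : Poly.isZero (Poly.add (Poly.add deg4_A_sosgram_Dinst_lieP_7 (Poly.neg deg4_A_sosgram_Dinst_lieP_6))
    (Poly.neg (Poly.norm (Poly.mul deg4_A_sosgram_Dinst_f_omega_3_poly (Poly.pderiv 6 deg4_A_sosgram_Dinst_V_poly))))) = true := by
  decide +kernel

set_option maxRecDepth 100000 in
/-- Final link: the certificate's `Vdot` polynomial equals the last partial sum `P_7 = Σ_k f_k·∂_kV` (one `decide`), hence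
IS the kernel Lie derivative of `V` along `f` (`Lyapunov/PolyRecastLieChunks.eval_eq_lieDeriv_of_links`). The one-`decide`
form `isZero (add Vdot (neg (lieDeriv f V)))` of the gen6 template does NOT reduce at this size (measured). [folklore] -/
theorem deg4_A_sosgram_Dinst_lieFinal : Poly.isZero (Poly.add deg4_A_sosgram_Dinst_Vdot_poly (Poly.neg deg4_A_sosgram_Dinst_lieP_7)) = true := by
  decide +kernel

/-- The seven links packaged in the shape `PolyRecastLieChunks` consumes (`Ps = [[], P₁, …, P₇]`). [folklore] -/
theorem deg4_A_sosgram_Dinst_lieLinks : ∀ k < 7, Poly.isZero (Poly.add (Poly.add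
      (([([] : Poly), deg4_A_sosgram_Dinst_lieP_1, deg4_A_sosgram_Dinst_lieP_2, deg4_A_sosgram_Dinst_lieP_3, deg4_A_sosgram_Dinst_lieP_4, deg4_A_sosgram_Dinst_lieP_5, deg4_A_sosgram_Dinst_lieP_6, deg4_A_sosgram_Dinst_lieP_7] : List Poly).getD (k + 1) [])
      (Poly.neg (([([] : Poly), deg4_A_sosgram_Dinst_lieP_1, deg4_A_sosgram_Dinst_lieP_2, deg4_A_sosgram_Dinst_lieP_3, deg4_A_sosgram_Dinst_lieP_4, deg4_A_sosgram_Dinst_lieP_5, deg4_A_sosgram_Dinst_lieP_6, deg4_A_sosgram_Dinst_lieP_7] : List Poly).getD k [])))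
    (Poly.neg (Poly.norm (Poly.mul (([deg4_A_sosgram_Dinst_f_sigma_2_poly, deg4_A_sosgram_Dinst_f_kappa_2_poly, deg4_A_sosgram_Dinst_f_sigma_3_poly, deg4_A_sosgram_Dinst_f_kappa_3_poly, deg4_A_sosgram_Dinst_f_omega_1_poly, deg4_A_sosgram_Dinst_f_omega_2_poly, deg4_A_sosgram_Dinst_f_omega_3_poly] : List Poly).getD k []) (Poly.pderiv k deg4_A_sosgram_Dinst_V_poly))))) = true := by
  intro k hk
  interval_cases k
  · exact deg4_A_sosgram_Dinst_lieLink_0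
  · exact deg4_A_sosgram_Dinst_lieLink_1
  · exact deg4_A_sosgram_Dinst_lieLink_2
  · exact deg4_A_sosgram_Dinst_lieLink_3
  · exact deg4_A_sosgram_Dinst_lieLink_4
  · exact deg4_A_sosgram_Dinst_lieLink_5
  · exact deg4_A_sosgram_Dinst_lieLink_6

end Summit.Ventures.GridStability.Bench.WSCC9
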